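import Mathlib
import Literature.Barriers.ValiantsHypothesis.MonotoneGapDecomposition
import Literature.Barriers.ValiantsHypothesis.MonotoneGapParseTrees
import Literature.Computability.AlgebraicComplexity.ArithCircuitProofs
import Summits.ValiantsHypothesis.ValiantsHypothesis.Theorems.DivisionGapPerMultiplesHardStubTypedDecomposition

/-!
# `DivisionGap.PerMultiplesHard` (stmt-ValiantsHypothesis-5068), line `uncharged-face-walk`:
the typed decomposition with the `(n/5, 2n/5]` row-support window
(stub `stub_typedDecompositionFifth`)

For `n ≥ 5`, a torus-homogeneous `g ∈ ℝ≥0[x_ij]` (`n × n` variables; all monomials have row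
margins `R` and column margins `C`) with all `R i ≠ 0` writes as `g = Σ_{t<s} a_t · b_t` with
`s ≤ L(g)` (`L = complexity`) and every `a_t` torus-homogeneous with margins `(ρ, γ)` whose row
support `k = #{i | ρ i ≠ 0}` satisfies `n < 5k ≤ 2n`.

Proof: the landed `(n/3, 2n/3]` version
(`Theorems/DivisionGapPerMultiplesHardStubTypedDecomposition.lean`, p89388) proves the descent
`exists_window_operand` for an ABSTRACT subadditive measure `μ` and threshold `N`
(window `N < 3μ ≤ 2N`, inputs `3μ(xᵢ) ≤ N`).  Running it with `μ = D · #rows` and `N = 3n` gives the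
window `n < D · #rows ≤ 2n` for every `3 ≤ D ≤ n` (`exists_window_gate_window`): the output hits
all `n` rows and `3Dn > 6n`; a variable has `3D ≤ 3n`.  The peeling induction
(`exists_typed_list_window`) and the final assembly are the landed ones with the window
parameter `D`; the stub is `D = 5`.

-- adapted from DivisionGapPerMultiplesHardStubTypedDecomposition.lean (p89388)
-/

noncomputable section

-- the namespace is mandated by the crux (`Summit.ValiantsHypothesis.ValiantsHypothesis.…`)
set_option linter.dupNamespace false

open MvPolynomial Literature.Computability.AlgebraicComplexity
open scoped NNReal BigOperators
open Literature.Barriers.ValiantsHypothesis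
open Literature.Computability.AlgebraicComplexity.ArithCircuit
open Summit.ValiantsHypothesis.ValiantsHypothesis.Theorems.DivisionGap.PerMultiplesHard.TypedDecomposition

namespace Summit.ValiantsHypothesis.ValiantsHypothesis.Theorems.DivisionGap.PerMultiplesHard.TypedDecompositionFifth

/-- **A gate in the window `(n/D, 2n/D]`.** If a fan-in-two circuit over `ℝ≥0` computes a nonzero
polynomial in the `n × n` variables all of whose monomials have the positive row margins `R`, and
`3 ≤ D ≤ n`, then some gate value `p` has row support of size `k` with `n < Dk ≤ 2n`: the abstract
descent `exists_window_operand` for the measure `D · #rows` and the threshold `3n` (the output hits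
all `n` rows, `3Dn > 6n`; a variable has measure `D`, `3D ≤ 3n`; constants have measure `0`).
[cite: JerrumSnir1982, §3.3 (proof of Thm. 3.4)] -/
theorem exists_window_gate_window (n D : ℕ) (hD : 3 ≤ D) (hDn : D ≤ n) (R : Fin n → ℕ)
    (hR : ∀ i, R i ≠ 0) (P : ArithCircuit ℝ≥0 (Fin n × Fin n)) (h2 : P.IsFanInTwo)
    (hg : ∀ m ∈ P.eval.support, ∀ i, ∑ j, m (i, j) = R i) (h0 : P.eval ≠ 0) :
    ∃ v : ℕ, n < D * (((gateValues P.gates).getD v 0).vars.image Prod.fst).card ∧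
      D * (((gateValues P.gates).getD v 0).vars.image Prod.fst).card ≤ 2 * n := by
  have huniv := image_fst_vars_eq_univ hg hR h0
  have hDn' : 3 * n ≤ D * n := Nat.mul_le_mul_right n hD
  have hout : 2 * (3 * n) < 3 * (D * (P.eval.vars.image Prod.fst).card) := by
    rw [huniv, Finset.card_univ, Fintype.card_fin]; omega
  obtain ⟨v, hlo, hhi⟩ := exists_window_operand P.gates h2
    (fun p : MvPolynomial (Fin n × Fin n) ℝ≥0 => D * (p.vars.image Prod.fst).card) (3 * n)
    (fun p q => by rw [← mul_add]; exact Nat.mul_le_mul_left D (card_image_fst_vars_add_le p q))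
    (fun p q => by rw [← mul_add]; exact Nat.mul_le_mul_left D (card_image_fst_vars_mul_le p q))
    (fun a p => Nat.mul_le_mul_left D (card_image_fst_vars_smul_le a p))
    (fun e => by rw [card_image_fst_vars_X]; omega)
    (fun a => by rw [card_image_fst_vars_C, mul_zero]) P.output hout
  exact ⟨v, by omega, by omega⟩

/-- **The peeling induction, window `(n/D, 2n/D]`.** A fan-in-two circuit over `ℝ≥0` whose gate
values vanish outside a set `Z` of at most `N` indices and whose output is typed with margins
`(R, C)`, all `R i > 0`, writes its output as a sum of at most `N` products `a · b`, every `a` typed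
with row support `k`, `n < Dk ≤ 2n` (`3 ≤ D ≤ n`): zero a window gate `v`
(`exists_eval_eq_zeroAt_add`), type `p_v` through `supp (p_v · q) ⊆ supp P.eval` when `q ≠ 0`, and
recurse on `P.zeroAt v`. [cite: JerrumSnir1982, §3 (Lemma 3.1(iii), Thm. 3.2)] -/
theorem exists_typed_list_window (n D : ℕ) (hD : 3 ≤ D) (hDn : D ≤ n) (R C : Fin n → ℕ)
    (hR : ∀ i, R i ≠ 0) :
    ∀ (N : ℕ) (P : ArithCircuit ℝ≥0 (Fin n × Fin n)), P.IsFanInTwo →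
      (∃ Z : Finset ℕ, Z.card ≤ N ∧ ∀ j ∉ Z, (gateValues P.gates).getD j 0 = 0) →
      (∀ m ∈ P.eval.support, (∀ i, ∑ j, m (i, j) = R i) ∧ (∀ j, ∑ i, m (i, j) = C j)) →
      ∃ L : List (MvPolynomial (Fin n × Fin n) ℝ≥0 × MvPolynomial (Fin n × Fin n) ℝ≥0),
        L.length ≤ N ∧ P.eval = (L.map fun ab => ab.1 * ab.2).sum ∧
        ∀ ab ∈ L, ∃ ρ γ : Fin n → ℕ,
          (∀ m ∈ ab.1.support, (∀ i, ∑ j, m (i, j) = ρ i) ∧ (∀ j, ∑ i, m (i, j) = γ j)) ∧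
          n < D * (Finset.univ.filter fun i => ρ i ≠ 0).card ∧
          D * (Finset.univ.filter fun i => ρ i ≠ 0).card ≤ 2 * n := by
  intro N
  induction N with
  | zero =>
    rintro P h2 ⟨Z, hZc, hZ0⟩ hg
    by_cases h0 : P.eval = 0
    · exact ⟨[], le_rfl, by simp [h0], by simp⟩
    · exfalso
      obtain ⟨v, hlo, -⟩ :=
        exists_window_gate_window n D hD hDn R hR P h2 (fun m hm => (hg m hm).1) h0
      have hv : (gateValues P.gates).getD v 0 = 0 :=
        hZ0 v (by simp [Finset.card_eq_zero.mp (Nat.le_zero.mp hZc)])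
      rw [hv, vars_0, Finset.image_empty, Finset.card_empty] at hlo
      omega
  | succ N ih =>
    rintro P h2 ⟨Z, hZc, hZ0⟩ hg
    by_cases h0 : P.eval = 0
    · exact ⟨[], by simp, by simp [h0], by simp⟩
    obtain ⟨v, hlo, hhi⟩ :=
      exists_window_gate_window n D hD hDn R hR P h2 (fun m hm => (hg m hm).1) h0
    obtain ⟨q, hq⟩ := exists_eval_eq_zeroAt_add P v
    have hlink := linked_gateValues_set P.gates v
    set p := (gateValues P.gates).getD v 0
    have hp0 : p ≠ 0 := by
      intro h
      rw [h, vars_0, Finset.image_empty, Finset.card_empty] at hlo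
      omega
    have hvZ : v ∈ Z := by_contra fun h => hp0 (hZ0 v h)
    -- the zeroed circuit: values vanish outside `Z.erase v`, output still typed
    have hZ' : ∃ Z' : Finset ℕ, Z'.card ≤ N ∧
        ∀ j ∉ Z', (gateValues (P.zeroAt v).gates).getD j 0 = 0 := by
      refine ⟨Z.erase v, ?_, fun j hj => ?_⟩
      · rw [Finset.card_erase_of_mem hvZ]; omega
      · by_cases hjv : j = v
        · subst hjv; exact getD_gateValues_set_zeroGate P.gates j
        · have hjZ : j ∉ Z := fun h => hj (Finset.mem_erase.mpr ⟨hjv, h⟩)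
          obtain ⟨h, hh⟩ := hlink.2 j
          rw [hZ0 j hjZ] at hh
          exact eq_zero_of_zero_eq_add hh
    have hg' : ∀ m ∈ (P.zeroAt v).eval.support,
        (∀ i, ∑ j, m (i, j) = R i) ∧ (∀ j, ∑ i, m (i, j) = C j) :=
      fun m hm => hg m (support_subset_of_eq_add hq hm)
    obtain ⟨L, hLlen, hLsum, hLtyp⟩ := ih (P.zeroAt v) (h2.zeroAt v) hZ' hg'
    by_cases hq0 : q = 0
    · refine ⟨L, by omega, ?_, hLtyp⟩
      rw [hq, hq0, mul_zero, add_zero, hLsum]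
    · have hsub : (p * q).support ⊆ P.eval.support :=
        support_subset_of_eq_add (hq.trans (add_comm _ _))
      obtain ⟨ρ, γ, hty⟩ := exists_margins_of_support_mul_subset hg hsub hq0
      refine ⟨(p, q) :: L, by simpa using hLlen, ?_, ?_⟩
      · simp only [List.map_cons, List.sum_cons]
        rw [hq, hLsum, add_comm]
      · intro ab hab
        rcases List.mem_cons.mp hab with rfl | hab
        · refine ⟨ρ, γ, hty, ?_⟩
          rw [filter_ne_zero_eq_image_fst_vars (fun m hm => (hty m hm).1) hp0]
          exact ⟨hlo, hhi⟩
        · exact hLtyp ab hab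

/-- **The typed decomposition with the window `(n/D, 2n/D]`, `3 ≤ D ≤ n`.** A torus-homogeneous
`g` over `ℝ≥0` (all monomials have margins `(R, C)`) with all `R i ≠ 0` writes as
`g = Σ_{t < s} a_t · b_t` with `s ≤ L(g)` and every `a_t` torus-homogeneous with margins `(ρ, γ)`,
`n < D · #{i | ρ i ≠ 0} ≤ 2n`: peel (`exists_typed_list_window`) a minimal fan-in-two circuit for
`g` (`exists_computes_size_eq_complexity`) at most `size = L(g)` times.
[cite: JerrumSnir1982, §3 (Lemma 3.1(iii), Thm. 3.2, proof of Thm. 3.4)] -/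
theorem typedDecompositionWindow (n D : ℕ) (hD : 3 ≤ D) (hDn : D ≤ n)
    (g : MvPolynomial (Fin n × Fin n) ℝ≥0) (R C : Fin n → ℕ)
    (hg : ∀ m ∈ g.support, (∀ i, ∑ j, m (i, j) = R i) ∧ (∀ j, ∑ i, m (i, j) = C j))
    (hR : ∀ i, R i ≠ 0) :
    ∃ s : ℕ, s ≤ complexity g ∧
      ∃ a b : Fin s → MvPolynomial (Fin n × Fin n) ℝ≥0,
        g = ∑ t, a t * b t ∧
        ∀ t, ∃ ρ γ : Fin n → ℕ,
          (∀ m ∈ (a t).support, (∀ i, ∑ j, m (i, j) = ρ i) ∧ (∀ j, ∑ i, m (i, j) = γ j)) ∧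
          n < D * (Finset.univ.filter fun i => ρ i ≠ 0).card ∧
          D * (Finset.univ.filter fun i => ρ i ≠ 0).card ≤ 2 * n := by
  obtain ⟨P, h2, hPg, hsize⟩ := exists_computes_size_eq_complexity g
  have heval : P.eval = g := hPg
  subst heval
  have hZ : ∃ Z : Finset ℕ, Z.card ≤ P.size ∧ ∀ j ∉ Z, (gateValues P.gates).getD j 0 = 0 := by
    refine ⟨Finset.range P.size, by simp, fun j hj => getD_gateValues_eq_zero ?_⟩
    exact List.getElem?_eq_none_iff.mpr (by simpa [ArithCircuit.size] using hj)
  obtain ⟨L, hLlen, hLsum, hLtyp⟩ := exists_typed_list_window n D hD hDn R C hR P.size P h2 hZ hg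
  refine ⟨L.length, hsize ▸ hLlen, fun t => (L[t.1]).1, fun t => (L[t.1]).2, ?_,
    fun t => hLtyp _ (List.getElem_mem _)⟩
  rw [Fin.sum_univ_fun_getElem L (fun ab => ab.1 * ab.2)]
  exact hLsum

/-- **The typed, row-support-balanced decomposition with the `(n/5, 2n/5]` window** (stub
`stub_typedDecompositionFifth`). For `n ≥ 5`, a torus-homogeneous `g` over `ℝ≥0` (all monomials
have margins `(R, C)`) with all `R i ≠ 0` writes as `g = Σ_{t < s} a_t · b_t` with `s ≤ L(g)` and
every `a_t` torus-homogeneous with margins `(ρ, γ)`, `n < 5 · #{i | ρ i ≠ 0} ≤ 2n`: the case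
`D = 5` of `typedDecompositionWindow`.
[cite: JerrumSnir1982, §3 (Lemma 3.1(iii), Thm. 3.2, proof of Thm. 3.4)] -/
theorem stub_typedDecompositionFifth :
    ∀ (n : ℕ), 5 ≤ n → ∀ (g : MvPolynomial (Fin n × Fin n) ℝ≥0) (R C : Fin n → ℕ),
      (∀ m ∈ g.support, (∀ i, ∑ j, m (i, j) = R i) ∧ (∀ j, ∑ i, m (i, j) = C j)) →
      (∀ i, R i ≠ 0) →
      ∃ s : ℕ, s ≤ complexity g ∧
        ∃ a b : Fin s → MvPolynomial (Fin n × Fin n) ℝ≥0,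
          g = ∑ t, a t * b t ∧
          ∀ t, ∃ ρ γ : Fin n → ℕ,
            (∀ m ∈ (a t).support, (∀ i, ∑ j, m (i, j) = ρ i) ∧ (∀ j, ∑ i, m (i, j) = γ j)) ∧
            n < 5 * (Finset.univ.filter fun i => ρ i ≠ 0).card ∧
            5 * (Finset.univ.filter fun i => ρ i ≠ 0).card ≤ 2 * n :=
  fun n hn g R C hg hR => typedDecompositionWindow n 5 (by norm_num) hn g R C hg hR

end Summit.ValiantsHypothesis.ValiantsHypothesis.Theorems.DivisionGap.PerMultiplesHard.TypedDecompositionFifth
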